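import Literature.Geometry.Riemannian.Necks
import Literature.Topology.FourManifolds.OrientedConnectedSumSphereSelf
import HarnessLib

/-!
# `ε`-necks as sets, the shrinking round cylinder, and strong (evolving) `ε`-necks (C⁰ form)
(topic `Geometry/Riemannian`)

Continuation of `Necks.lean` (layer RF4₀ of the decomposition of
`Literature.Geometry.Riemannian.hamilton_chen_tang_zhu`, `HamiltonPICProofs.lean`), supplying the vocabulary of
the canonical neighbourhood statements of Chen–Zhu 2006, §§3–5:

* `IsEpsCloseAlong G h c ψ ε` — the closeness relation used throughout: along the map `ψ` of the
  strip `Sᵐ × (-L, L)` into `M`, the rescaled pulled-back metric `c · ψ^* h` is pointwise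
  `ε`-close to the model metric `G` of the cylinder, `|c h(dψ v, dψ w) - G(v, w)| ≤ ε |v|_G |w|_G`
  (the `C⁰` part, condition (A) of Hamilton 1997, §C2, p. 31, of the sources' `C^{[ε⁻¹]}`
  closeness — see `Necks.lean` for this standing weakening).
* `IsEpsNeck m g N ε r` — **the open set `N ⊆ M` is an `ε`-neck of radius `r`** (Chen–Zhu 2006,
  §2, p. 4: "We call an open subset `N ⊂ Mⁿ` to be an `ε`-neck of radius `r` if `(N, r⁻²g)` is
  `ε`-close, in `C^{[ε⁻¹]}` topology, to a standard neck `Sⁿ⁻¹ × 𝕀` with `𝕀` of the length `2ε⁻¹`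
  and `Sⁿ⁻¹` of the scalar curvature `1`"), C⁰ form: `N` is the (open) image of a neck chart
  along which `r⁻² g` is `ε`-close to `standardNeckMetric`. The pointed notions of `Necks.lean`
  are recovered: `LiesInEpsNeck m g x ε r ↔ ∃ N, x ∈ N ∧ IsEpsNeck m g N ε r`
  (`liesInEpsNeck_iff_exists_isEpsNeck`, proved).
* `evolvingNeckFactor m s`, `evolvingNeckMetric V s` — **the evolving standard round cylinder**
  `Sᵐ × ℝ` under the Ricci flow, normalised to scalar curvature `1` at time `0`: at time `s ≤ 0`
  the sphere factor is round of radius `ρ(s)`, `ρ² = (m-1)(m-2s)` (from `dρ²/dt = -2(m-1)`,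
  `ρ(0)² = m(m-1)`), the line factor is `dz²` (Chen–Zhu 2006, §3, pp. 9–10 and Thm. 3.8 (a): "the
  evolving round cylinder `ℝ × S³`, having scalar curvature one at `t = 0`"; for `m = 3`,
  `ρ² = 6 - 4s`). At `s = 0` it is `standardNeckMetric` (`evolvingNeckMetric_zero`).
* `IsStrongEpsNeck m g S B t Q ε` — **`B` is a strong `ε`-neck at time `t`, at the curvature
  scale `Q`**, for a family of metrics `g : ℝ → …` defined (at least) on the time set `S`
  (Chen–Zhu 2006, §5, canonical neighbourhood assumption (a), arXiv p. 26: "`B` is an `ε`-neck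
  and it is the slice at time `t` of the parabolic neighborhood
  `{(x', t') | x' ∈ B, t' ∈ [t - R(x,t)⁻¹, t]}`, where the solution is well defined on the whole
  parabolic neighborhood and is, after scaling with factor `R(x,t)` and shifting the time to
  zero, `ε`-close (in `C^{[ε⁻¹]}` topology) to the corresponding subset of the evolving standard
  round cylinder `S³ × ℝ` with scalar curvature `1` at the time zero"; here `Q` stands for
  `R(x,t)`), C⁰ form: `[t - Q⁻¹, t] ⊆ S`, and one neck chart `ψ` with image `B` along which, for
  every `s ∈ [-1, 0]`, `Q · ψ^* g(t + s/Q)` is `ε`-close to `evolvingNeckMetric s`.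
* Non-vacuity (PROVED): the strip `Sᵐ × (-ε⁻¹, ε⁻¹)` of the standard neck is an `ε`-neck of
  radius `1` (`isEpsNeck_standardNeck`), and is a strong `ε`-neck at time `0`, scale `1`, for the
  shrinking cylinder `s ↦ evolvingNeckMetric s` (`isStrongEpsNeck_evolvingNeckMetric`).

As in `Necks.lean`, statements vendored later that *assume* necks must not use these `C⁰`
notions in hypotheses (they are weaker than the sources'); statements that *produce* necks may.

## References

* B.-L. Chen, X.-P. Zhu, *Ricci flow with surgery on four-manifolds with positive isotropic
  curvature*, J. Differential Geom. 74 (2006) 177–264 (arXiv:math/0504478): §2 (ε-necks), §3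
  pp. 9–10 (evolving ε-necks) and Thm. 3.8 (a), §5 (canonical neighbourhood assumption (a), strong
  ε-necks). [ChenZhu2006]
* R. S. Hamilton, *Four-manifolds with positive isotropic curvature*, Comm. Anal. Geom. 5 (1997),
  §3.2 (Section C2, p. 31, condition (A)). [Hamilton1997]
* P. Topping, *Lectures on the Ricci flow* (2006), §1.2.1–1.2.2 (shrinking spheres and
  cylinders). [Topping2006]

## Imports (refactor wi-07965)

`Necks.lean` no longer imports the connected-sum tower
(`Literature.Topology.FourManifolds.OrientedConnectedSumSphereSelf`); the derivative of the
inclusion of an open submanifold now comes from `Literature.Geometry.Manifold.OpenSubmanifoldMFDeriv`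
(`Literature.Geometry.Manifold.OpenSubmanifold.mfderiv_subtype_val`). This file keeps an explicit
`import Literature.Topology.FourManifolds.OrientedConnectedSumSphereSelf` TRANSITIONALLY, so that the
import closure of its importers (`CkNecks`, `CanonicalNeighbourhoods` and the Ricci-flow-with-surgery
files above it) is unchanged by that refactor; it is to be removed once those importers import what
they use.
-/

noncomputable section

open Bundle Set Metric Module TopologicalSpace
open scoped Manifold ContDiff Topology EuclideanSpace

namespace Literature.Geometry.Riemannian

open Lorentzian Lorentzian.PseudoRiemannianMetric

/-- Local notation: the standard unit `m`-sphere `𝕊 m ⊂ ℝᵐ⁺¹`. -/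
local notation "𝕊 " m:arg => (Metric.sphere (0 : EuclideanSpace ℝ (Fin (m + 1))) 1)

section Closeness

variable {E : Type*} [NormedAddCommGroup E] [NormedSpace ℝ E] {H : Type*} [TopologicalSpace H]
  {I : ModelWithCorners ℝ E H} {M : Type*} [TopologicalSpace M] [ChartedSpace H M]
  [IsManifold I ∞ M] {m : ℕ} {L : ℝ}

/-- **`C⁰`-closeness along a neck chart.** For a model metric `G` on the cylinder `Sᵐ × ℝ`, a
metric `h` on `M`, a scaling constant `c` and a map `ψ` of the strip `Sᵐ × (-L, L)` into `M`:
pointwise on the strip, `|c · h(dψ v, dψ w) - G(v, w)| ≤ ε |v|_G |w|_G` — the rescaled pulled-back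
metric `c ψ^* h` is within `ε` of `G` in the `G`-norm (condition (A) `|ĝ - ḡ|_ḡ < ε` of Hamilton
1997, §C2, p. 31, up to `≤`/`<`; the `C⁰` part of Chen–Zhu's `C^{[ε⁻¹]}`-closeness).
[cite: Hamilton1997, §3.2 (C2), p. 31, condition (A)] [cite: ChenZhu2006, §2, p. 4] -/
def IsEpsCloseAlong
    (G : PseudoRiemannianMetric ((𝓡 m).prod 𝓘(ℝ, ℝ)) ∞ (EuclideanSpace ℝ (Fin m) × ℝ)
      (TangentSpace ((𝓡 m).prod 𝓘(ℝ, ℝ)) : (𝕊 m) × ℝ → Type _))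
    (h : PseudoRiemannianMetric I ∞ E (TangentSpace I : M → Type _)) (c : ℝ)
    (ψ : neckStrip (EuclideanSpace ℝ (Fin (m + 1))) L → M) (ε : ℝ) : Prop :=
  ∀ (p : neckStrip (EuclideanSpace ℝ (Fin (m + 1))) L)
    (v w : TangentSpace ((𝓡 m).prod 𝓘(ℝ, ℝ)) p),
    |c * h.val (ψ p) (mfderiv ((𝓡 m).prod 𝓘(ℝ, ℝ)) I ψ p v) (mfderiv ((𝓡 m).prod 𝓘(ℝ, ℝ)) I ψ p w) -
        G.val (p : (𝕊 m) × ℝ) v w| ≤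
      ε * Real.sqrt (G.val (p : (𝕊 m) × ℝ) v v) * Real.sqrt (G.val (p : (𝕊 m) × ℝ) w w)

/-- Closeness is monotone in `ε` (square roots being nonnegative). [folklore] -/
theorem IsEpsCloseAlong.mono
    {G : PseudoRiemannianMetric ((𝓡 m).prod 𝓘(ℝ, ℝ)) ∞ (EuclideanSpace ℝ (Fin m) × ℝ)
      (TangentSpace ((𝓡 m).prod 𝓘(ℝ, ℝ)) : (𝕊 m) × ℝ → Type _)}
    {h : PseudoRiemannianMetric I ∞ E (TangentSpace I : M → Type _)} {c : ℝ}
    {ψ : neckStrip (EuclideanSpace ℝ (Fin (m + 1))) L → M} {ε ε' : ℝ}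
    (hcl : IsEpsCloseAlong G h c ψ ε) (hε : ε ≤ ε') : IsEpsCloseAlong G h c ψ ε' :=
  fun p v w ↦ (hcl p v w).trans (by gcongr)

/-- **The model case**: along the inclusion of the strip, any model metric is `0`-close, hence
`ε`-close for every `ε ≥ 0`, to itself at scale `1` (the differential of the inclusion of an open
submanifold is the identity, `Literature.Geometry.Manifold.OpenSubmanifold.mfderiv_subtype_val`; square roots are nonnegative). [folklore] -/
theorem isEpsCloseAlong_self_subtypeVal
    (G : PseudoRiemannianMetric ((𝓡 m).prod 𝓘(ℝ, ℝ)) ∞ (EuclideanSpace ℝ (Fin m) × ℝ)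
      (TangentSpace ((𝓡 m).prod 𝓘(ℝ, ℝ)) : (𝕊 m) × ℝ → Type _))
    {ε : ℝ} (hε : 0 ≤ ε) :
    IsEpsCloseAlong (I := (𝓡 m).prod 𝓘(ℝ, ℝ)) G G 1
      (Subtype.val : neckStrip (EuclideanSpace ℝ (Fin (m + 1))) L → (𝕊 m) × ℝ) ε := by
  intro p v w
  rw [Literature.Geometry.Manifold.OpenSubmanifold.mfderiv_subtype_val p]
  change |1 * G.val (p : (𝕊 m) × ℝ) v w - G.val (p : (𝕊 m) × ℝ) v w| ≤
    ε * Real.sqrt (G.val (p : (𝕊 m) × ℝ) v v) * Real.sqrt (G.val (p : (𝕊 m) × ℝ) w w)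
  rw [one_mul, sub_self, abs_zero]
  positivity

end Closeness

/-! ### `ε`-necks as open sets -/

section NeckSet

variable {E : Type*} [NormedAddCommGroup E] [NormedSpace ℝ E] {H : Type*} [TopologicalSpace H]
  {I : ModelWithCorners ℝ E H} {M : Type*} [TopologicalSpace M] [ChartedSpace H M]
  [IsManifold I ∞ M]

/-- **The open set `N ⊆ M` is an `ε`-neck of radius `r` in `(M, g)`** (Chen–Zhu 2006, §2, p. 4:
"an open subset `N ⊂ Mⁿ` [is] an `ε`-neck of radius `r` if `(N, r⁻² g)` is `ε`-close, in
`C^{[ε⁻¹]}` topology, to a standard neck `Sⁿ⁻¹ × 𝕀` with `𝕀` of the length `2ε⁻¹` and `Sⁿ⁻¹` of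
the scalar curvature `1`"), **C⁰ form**: `N` is the image of a smooth embedding `ψ` of the strip
`Sᵐ × (-ε⁻¹, ε⁻¹)`, open in `M`, along which `r⁻² g` is `ε`-close to `standardNeckMetric`
(`IsEpsCloseAlong`; only the `C⁰` part of the closeness, see the module docstring).
[cite: ChenZhu2006, §2, p. 4] [cite: Hamilton1997, §3.2 (C2), p. 31, condition (A)] -/
structure IsEpsNeck (m : ℕ) (g : PseudoRiemannianMetric I ∞ E (TangentSpace I : M → Type _))
    (N : Set M) (ε r : ℝ) : Prop where
  /-- `ε` and the radius `r` are positive. -/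
  pos : 0 < ε ∧ 0 < r
  /-- `N` is open. -/
  isOpen : IsOpen N
  /-- A neck chart with image `N` along which `r⁻² g` is `ε`-close to the standard neck. -/
  exists_neckChart : ∃ ψ : neckStrip (EuclideanSpace ℝ (Fin (m + 1))) ε⁻¹ → M,
    Manifold.IsSmoothEmbedding ((𝓡 m).prod 𝓘(ℝ, ℝ)) I ∞ ψ ∧ range ψ = N ∧
    IsEpsCloseAlong (standardNeckMetric (m := m) (EuclideanSpace ℝ (Fin (m + 1)))) g (r⁻¹ ^ 2) ψ ε

variable {m : ℕ} {g : PseudoRiemannianMetric I ∞ E (TangentSpace I : M → Type _)} {x : M}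
  {N : Set M} {ε r : ℝ}

/-- The closeness parameter of a neck is positive. [folklore] -/
theorem IsEpsNeck.eps_pos (h : IsEpsNeck m g N ε r) : 0 < ε := h.pos.1

/-- The radius of a neck is positive. [folklore] -/
theorem IsEpsNeck.radius_pos (h : IsEpsNeck m g N ε r) : 0 < r := h.pos.2

/-- A neck is nonempty (the strip `Sᵐ × (-ε⁻¹, ε⁻¹)` is). [folklore] -/
theorem IsEpsNeck.nonempty (h : IsEpsNeck m g N ε r) : N.Nonempty := by
  obtain ⟨ψ, -, hrange, -⟩ := h.exists_neckChart
  have hε : 0 < ε⁻¹ := inv_pos.2 h.eps_pos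
  obtain ⟨y⟩ : Nonempty (𝕊 m) := (NormedSpace.sphere_nonempty.2 zero_le_one).to_subtype
  have hp : ((y, (0 : ℝ)) : (𝕊 m) × ℝ) ∈ neckStrip (EuclideanSpace ℝ (Fin (m + 1))) ε⁻¹ := by
    simp [hε]
  exact ⟨ψ ⟨(y, 0), hp⟩, hrange ▸ mem_range_self _⟩

/-- **A point lies in some `ε`-neck iff it belongs to an open set which is an `ε`-neck**: the
pointed notion `LiesInEpsNeck` of `Necks.lean` and the set notion agree (same chart, same
closeness). [cite: ChenZhu2006, §2, p. 4] -/
theorem liesInEpsNeck_iff_exists_isEpsNeck :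
    LiesInEpsNeck m g x ε r ↔ ∃ N : Set M, x ∈ N ∧ IsEpsNeck m g N ε r := by
  constructor
  · rintro ⟨hpos, ψ, hψ, hopen, hx, hclose⟩
    exact ⟨range ψ, hx, hpos, hopen, ψ, hψ, rfl, hclose⟩
  · rintro ⟨N, hxN, hpos, hopen, ψ, hψ, hrange, hclose⟩
    subst hrange
    exact ⟨hpos, ψ, hψ, hopen, hxN, hclose⟩

/-- Every point of an `ε`-neck lies in an `ε`-neck. [cite: ChenZhu2006, §2, p. 4] -/
theorem IsEpsNeck.liesInEpsNeck (h : IsEpsNeck m g N ε r) (hx : x ∈ N) : LiesInEpsNeck m g x ε r :=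
  liesInEpsNeck_iff_exists_isEpsNeck.2 ⟨N, hx, h⟩

/-- The centre of an `ε`-neck belongs to an open `ε`-neck. [cite: ChenZhu2006, §2, p. 4] -/
theorem IsCenterOfEpsNeck.exists_isEpsNeck (h : IsCenterOfEpsNeck m g x ε r) :
    ∃ N : Set M, x ∈ N ∧ IsEpsNeck m g N ε r :=
  liesInEpsNeck_iff_exists_isEpsNeck.1 h.liesInEpsNeck

/-- **Non-vacuity / the model case**: the strip `Sᵐ × (-ε⁻¹, ε⁻¹)` of the standard neck
`(Sᵐ × ℝ, g_neck)` is an `ε`-neck of radius `1`, for every `ε > 0` (chart: the inclusion).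
[cite: ChenZhu2006, §2, p. 4] -/
theorem isEpsNeck_standardNeck (m : ℕ) {ε : ℝ} (hε : 0 < ε) :
    IsEpsNeck m (standardNeckMetric (m := m) (EuclideanSpace ℝ (Fin (m + 1))))
      (neckStrip (EuclideanSpace ℝ (Fin (m + 1))) ε⁻¹ : Set ((𝕊 m) × ℝ)) ε 1 := by
  refine ⟨⟨hε, one_pos⟩, (neckStrip (EuclideanSpace ℝ (Fin (m + 1))) ε⁻¹).2, Subtype.val,
    Manifold.IsSmoothEmbedding.of_opens _, Subtype.range_coe, ?_⟩
  have h1 : ((1 : ℝ)⁻¹ ^ 2) = 1 := by norm_num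
  rw [h1]
  exact isEpsCloseAlong_self_subtypeVal _ hε.le

end NeckSet

/-! ### The evolving round cylinder -/

section Evolving

variable (V : Type*) [NormedAddCommGroup V] [InnerProductSpace ℝ V] {m : ℕ}
  [Fact (finrank ℝ V = m + 1)]

/-- The squared radius `ρ(s)² = (m-1)(m-2s)` of the sphere factor of the evolving round cylinder
`Sᵐ × ℝ` at time `s ≤ 0`, normalised to scalar curvature `1` (radius `√(m(m-1))`) at `s = 0`:
under the Ricci flow a round `Sᵐ` of radius `ρ` has `dρ²/dt = -2(m-1)` (Topping 2006, §1.2.1;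
Chen–Zhu 2006, §3, pp. 9–10). Junk value `1` for `m ≤ 1` or `s > 0` (outside the intended range).
[cite: ChenZhu2006, §3, pp. 9–10] [cite: Topping2006, §1.2.1] -/
def evolvingNeckFactor (m : ℕ) (s : ℝ) : ℝ :=
  if 2 ≤ m ∧ s ≤ 0 then ((m : ℝ) - 1) * ((m : ℝ) - 2 * s) else 1

omit [Fact (finrank ℝ V = m + 1)] in
/-- The evolving factor is positive. [folklore] -/
theorem evolvingNeckFactor_pos (m : ℕ) (s : ℝ) : 0 < evolvingNeckFactor m s := by
  unfold evolvingNeckFactor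
  split_ifs with h
  · obtain ⟨hm, hs⟩ := h
    have h2 : (2 : ℝ) ≤ m := by exact_mod_cast hm
    exact mul_pos (by linarith) (by linarith)
  · exact one_pos

omit [Fact (finrank ℝ V = m + 1)] in
/-- At time `0` the factor is Chen–Zhu's normalisation `m(m-1)` (junk `1` for `m ≤ 1`), the
factor of `standardNeckMetric`. [cite: ChenZhu2006, §2, p. 4] -/
theorem evolvingNeckFactor_zero (m : ℕ) :
    evolvingNeckFactor m 0 = if 2 ≤ m then (m : ℝ) * ((m : ℝ) - 1) else 1 := by
  unfold evolvingNeckFactor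
  by_cases hm : 2 ≤ m
  · simp [hm]; ring
  · simp [hm]

omit [Fact (finrank ℝ V = m + 1)] in
/-- For `m = 3` (the case of 4-manifolds): `ρ(s)² = 6 - 4s`. [cite: ChenZhu2006, §3, pp. 9–10] -/
theorem evolvingNeckFactor_three {s : ℝ} (hs : s ≤ 0) : evolvingNeckFactor 3 s = 6 - 4 * s := by
  unfold evolvingNeckFactor
  rw [if_pos ⟨by norm_num, hs⟩]
  norm_num
  ring

/-- **The evolving standard round cylinder** `Sᵐ × ℝ` at time `s ≤ 0`: the product of the round
metric of radius `ρ(s)`, `ρ² = (m-1)(m-2s)` (`evolvingNeckFactor m s • g_round`), and `dz²` —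
the Ricci flow of round cylinders through the standard neck (scalar curvature `1`) at `s = 0`
(Chen–Zhu 2006, §3, pp. 9–10: "the evolving round cylinder `ℝ × S³`, having scalar curvature one
at `t = 0`"; Thm. 3.8 (a); Topping 2006, §1.2.2). [cite: ChenZhu2006, §3, pp. 9–10] -/
def evolvingNeckMetric (s : ℝ) : PseudoRiemannianMetric ((𝓡 m).prod 𝓘(ℝ, ℝ)) ∞
    (EuclideanSpace ℝ (Fin m) × ℝ)
    (TangentSpace ((𝓡 m).prod 𝓘(ℝ, ℝ)) : sphere (0 : V) 1 × ℝ → Type _) :=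
  ((roundMetric (n := m) V).constSmul (evolvingNeckFactor m s)
    (evolvingNeckFactor_pos m s).ne').prod (euclideanMetric ℝ)

variable {V}

/-- The evolving cylinder metrics are Riemannian. [cite: ChenZhu2006, §3, pp. 9–10] -/
theorem isRiemannian_evolvingNeckMetric (s : ℝ) :
    (evolvingNeckMetric (m := m) V s).IsRiemannian :=
  (isRiemannian_roundMetric.constSmul (evolvingNeckFactor_pos m s)).prod
    isRiemannian_euclideanMetric

/-- At time `0` the evolving cylinder is the standard neck. [cite: ChenZhu2006, §2, p. 4] -/
theorem evolvingNeckMetric_zero :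
    evolvingNeckMetric (m := m) V 0 = standardNeckMetric (m := m) V := by
  unfold evolvingNeckMetric standardNeckMetric
  congr 1
  ext b v w
  simp only [constSmul_apply, evolvingNeckFactor_zero]

end Evolving

/-! ### Strong (evolving) `ε`-necks -/

section Strong

variable {E : Type*} [NormedAddCommGroup E] [NormedSpace ℝ E] {H : Type*} [TopologicalSpace H]
  {I : ModelWithCorners ℝ E H} {M : Type*} [TopologicalSpace M] [ChartedSpace H M]
  [IsManifold I ∞ M]

/-- **`B` is a strong `ε`-neck at time `t`, at curvature scale `Q`**, for the family of metrics
`g : ℝ → …` on the time set `S` (Chen–Zhu 2006, §5, canonical neighbourhood assumption (a),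
arXiv p. 26, quoted in the module docstring; `Q` stands for `R(x, t)`), **C⁰ form**: `ε, Q > 0`;
the parabolic neighbourhood's time interval `[t - Q⁻¹, t]` lies in `S` ("the solution is well
defined on the whole parabolic neighborhood"); `B` is open and is the image of one smooth
embedding `ψ` of the strip `Sᵐ × (-ε⁻¹, ε⁻¹)` along which, for every rescaled time
`s ∈ [-1, 0]`, the metric `Q · g(t + s/Q)` ("scaling with factor `R(x,t)` and shifting the time
to zero") is `ε`-close (`IsEpsCloseAlong`, `C⁰`) to the evolving round cylinder
`evolvingNeckMetric s` of scalar curvature `1` at time zero. In particular the slice `B` at time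
`t` is an `ε`-neck of radius `Q^{-1/2}` (`IsStrongEpsNeck.isEpsNeck`).
[cite: ChenZhu2006, §5, p. 26, canonical neighborhood assumption (a)] -/
structure IsStrongEpsNeck (m : ℕ)
    (g : ℝ → PseudoRiemannianMetric I ∞ E (TangentSpace I : M → Type _)) (S : Set ℝ)
    (B : Set M) (t Q ε : ℝ) : Prop where
  /-- `ε` and the scale `Q` are positive. -/
  pos : 0 < ε ∧ 0 < Q
  /-- The parabolic neighbourhood's times `[t - Q⁻¹, t]` belong to the time set of the flow. -/
  Icc_subset : Icc (t - Q⁻¹) t ⊆ S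
  /-- `B` is open. -/
  isOpen : IsOpen B
  /-- One neck chart with image `B` along which the rescaled, time-shifted flow is `ε`-close to
  the evolving round cylinder for all rescaled times `s ∈ [-1, 0]`. -/
  exists_neckChart : ∃ ψ : neckStrip (EuclideanSpace ℝ (Fin (m + 1))) ε⁻¹ → M,
    Manifold.IsSmoothEmbedding ((𝓡 m).prod 𝓘(ℝ, ℝ)) I ∞ ψ ∧ range ψ = B ∧
    ∀ s ∈ Icc (-1 : ℝ) 0,
      IsEpsCloseAlong (evolvingNeckMetric (m := m) (EuclideanSpace ℝ (Fin (m + 1))) s)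
        (g (t + s / Q)) Q ψ ε

variable {m : ℕ} {g : ℝ → PseudoRiemannianMetric I ∞ E (TangentSpace I : M → Type _)}
  {S : Set ℝ} {B : Set M} {t Q ε : ℝ}

/-- The base time of a strong neck belongs to the time set. [folklore] -/
theorem IsStrongEpsNeck.mem (h : IsStrongEpsNeck m g S B t Q ε) : t ∈ S :=
  h.Icc_subset ⟨by linarith [inv_pos.2 h.pos.2], le_rfl⟩

/-- **The time-`t` slice of a strong `ε`-neck at scale `Q` is an `ε`-neck of radius `Q^{-1/2}`**
(take `s = 0`: `evolvingNeckMetric 0 = standardNeckMetric` and `(Q^{-1/2})⁻² = Q`).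
[cite: ChenZhu2006, §5, p. 26, canonical neighborhood assumption (a)] -/
theorem IsStrongEpsNeck.isEpsNeck (h : IsStrongEpsNeck m g S B t Q ε) :
    IsEpsNeck m (g t) B ε (Real.sqrt Q)⁻¹ := by
  obtain ⟨ψ, hψ, hrange, hclose⟩ := h.exists_neckChart
  refine ⟨⟨h.pos.1, inv_pos.2 (Real.sqrt_pos.2 h.pos.2)⟩, h.isOpen, ψ, hψ, hrange, ?_⟩
  have h0 := hclose 0 ⟨by norm_num, le_rfl⟩
  rw [evolvingNeckMetric_zero, zero_div, add_zero] at h0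
  have hQ : ((Real.sqrt Q)⁻¹)⁻¹ ^ 2 = Q := by
    rw [inv_inv, Real.sq_sqrt h.pos.2.le]
  rwa [hQ]

/-- **Non-vacuity / the model case**: for the shrinking cylinder `s ↦ evolvingNeckMetric s` on
`Sᵐ × ℝ`, on the time set `[-1, 0]`, the strip `Sᵐ × (-ε⁻¹, ε⁻¹)` is a strong `ε`-neck at time
`0` and scale `1`, for every `ε > 0` (chart: the inclusion; closeness `0`).
[cite: ChenZhu2006, §5, p. 26, canonical neighborhood assumption (a)] -/
theorem isStrongEpsNeck_evolvingNeckMetric (m : ℕ) {ε : ℝ} (hε : 0 < ε) :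
    IsStrongEpsNeck m (fun s ↦ evolvingNeckMetric (m := m) (EuclideanSpace ℝ (Fin (m + 1))) s)
      (Icc (-1 : ℝ) 0) (neckStrip (EuclideanSpace ℝ (Fin (m + 1))) ε⁻¹ : Set ((𝕊 m) × ℝ)) 0 1 ε := by
  refine ⟨⟨hε, one_pos⟩, by norm_num, (neckStrip (EuclideanSpace ℝ (Fin (m + 1))) ε⁻¹).2,
    Subtype.val, Manifold.IsSmoothEmbedding.of_opens _, Subtype.range_coe, fun s hs ↦ ?_⟩
  simp only [zero_add, div_one]
  exact isEpsCloseAlong_self_subtypeVal _ hε.le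

end Strong

end Literature.Geometry.Riemannian

end
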